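import Mathlib
import Summits.NavierStokesRegularity.NavierStokesRegularity.Theorems.FilamentSkeletonRssClause13ModelPieceWindow

/-!
# Clause 13-J/13-R, edge brick E2 (EXTERIOR INDUCTION OF A CLAMPED FIELD IN `L²`: controlled by `‖Y′‖₂` through the kernel's tail integral)

Route `FilamentSkeletonRss`, ∃-side clause 13 (`Clause13RNearStraightL`, stmt-NavierStokesRegularity-23612; typing-agnostic).  Companion of
`…Clause13ExteriorInduction` (E1, pointwise, near-edge slope); design of record: lane memo `filament-plan/DESIGN-23612-currency-b-edge-lane-g19.md`
§9/§10.  For a test variation `Y ∈ C¹_c` that vanishes on `[e, ∞)`, the induction `∫ K(x−σ)Y(σ)dσ` at exterior points `x > e` equals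
`∫ K̃(x−σ)Y′(σ)dσ` for ANY `C¹` antiderivative `K̃` of the kernel (`K̃′ = K`; integration by parts, `piece_deriv_eq_derivKernel_piece`), and only
`K̃` on `(0, ∞)` enters; hence the exterior `L²` mass is bounded through Young's inequality by the tail integral `∫_{(0,∞)}|K̃|` and `‖Y′‖₂`.
This is the `L²` currency in which the band-piece Mourre pairing and the global `L²` layer consume the exterior sliver, with `‖Y′‖₂` the quantity
the (clamped) low-piece Dirichlet estimate controls.

* `kernel_piece_eq_antideriv_piece_deriv` — `∫ K(x−σ)Y(σ)dσ = ∫ K̃(x−σ)·Y′(σ)dσ` (all `x`);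
* `deriv_eq_zero_of_clamped` — `Y′ = 0` on `[e, ∞)` when `Y = 0` there (`C¹`);
* ★ `integral_Ioi_sq_norm_kernel_clamped_le` — `∫_{x>e} ‖∫K(x−σ)Y(σ)dσ‖² ≤ (∫_{t>0}|K̃(t)|)²·∫‖Y′‖²`.
Lane ns-filament-19175-p1 g19; `--supports stmt-NavierStokesRegularity-23612 --as helper`.
HONEST FRAMING: an elementary inequality used in the bookkeeping of a HYPOTHETICAL filament skeleton on the NEGATIVE side of a MODEL route; nothing here
bears on Navier–Stokes regularity or blow-up.
-/

noncomputable section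

open MeasureTheory Real Set

namespace Summit.NavierStokesRegularity.NavierStokesRegularity.Theorems.MatchedKernel
set_option linter.dupNamespace false

/-- **Integration by parts onto the antiderivative of the kernel**: for `K̃ ∈ C¹` with `K̃′ = K` continuous and `Y ∈ C¹_c`,
`∫ K(x−σ)·Y(σ) dσ = ∫ K̃(x−σ)·Y′(σ) dσ`. [folklore] -/
theorem kernel_piece_eq_antideriv_piece_deriv {K Kt : ℝ → ℝ} (hKt : ∀ t, HasDerivAt Kt (K t) t) (hKc : Continuous K)
    {Y : ℝ → ℂ} (hY : ContDiff ℝ 1 Y) (hYs : HasCompactSupport Y) (x : ℝ) :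
    ∫ σ : ℝ, ((K (x - σ) : ℝ) : ℂ) * Y σ = ∫ σ : ℝ, ((Kt (x - σ) : ℝ) : ℂ) * deriv Y σ :=
  (piece_deriv_eq_derivKernel_piece hKt hKc hY hYs x).symm

/-- **A `C¹` field vanishing on `[e, ∞)` has vanishing derivative there** (right-derivative of the zero function; uniqueness on `Ici e`).
[folklore] -/
theorem deriv_eq_zero_of_clamped {Y : ℝ → ℂ} (hY : ContDiff ℝ 1 Y) {e : ℝ} (hYe : ∀ σ, e ≤ σ → Y σ = 0)
    {σ : ℝ} (hσ : e ≤ σ) : deriv Y σ = 0 := by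
  have hd : HasDerivAt Y (deriv Y σ) σ := (hY.differentiable one_ne_zero σ).hasDerivAt
  have hd1 : HasDerivWithinAt Y (deriv Y σ) (Ici σ) σ := hd.hasDerivWithinAt
  -- on `Ici σ ⊆ Ici e` the field is identically zero
  have hzero : HasDerivWithinAt Y 0 (Ici σ) σ := by
    have hconst : HasDerivWithinAt (fun _ : ℝ => (0 : ℂ)) 0 (Ici σ) σ := hasDerivWithinAt_const _ _ _
    refine hconst.congr (fun y hy => ?_) ?_
    · exact hYe y (le_trans hσ hy)
    · exact hYe σ hσ
  exact (uniqueDiffWithinAt_Ici σ).eq_deriv _ hd1 hzero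

/-- **EXTERIOR INDUCTION OF A CLAMPED FIELD IN `L²`.**  Let `K` be continuous with a `C¹` antiderivative `K̃` (`K̃′ = K`) integrable on `(0, ∞)`;
let `Y ∈ C¹_c(ℝ, ℂ)` vanish on `[e, ∞)`.  Then `∫_{x ∈ (e,∞)} ‖∫ K(x−σ)Y(σ) dσ‖² ≤ (∫_{t ∈ (0,∞)} |K̃(t)|)² · ∫ ‖Y′‖²`.
(For `x > e` only `σ < e` contributes, where `x − σ > 0`; Young's inequality with the kernel `𝟙_{(0,∞)}|K̃|`.) [folklore] -/
theorem integral_Ioi_sq_norm_kernel_clamped_le {K Kt : ℝ → ℝ} (hKt : ∀ t, HasDerivAt Kt (K t) t) (hKc : Continuous K)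
    (hKti : IntegrableOn Kt (Ioi 0)) {Y : ℝ → ℂ} (hY : ContDiff ℝ 1 Y) (hYs : HasCompactSupport Y) {e : ℝ}
    (hYe : ∀ σ, e ≤ σ → Y σ = 0) :
    ∫ x in Ioi e, ‖∫ σ : ℝ, ((K (x - σ) : ℝ) : ℂ) * Y σ‖ ^ 2
      ≤ (∫ t in Ioi 0, |Kt t|) ^ 2 * ∫ σ : ℝ, ‖deriv Y σ‖ ^ 2 := by
  have hKtc : Continuous Kt := continuous_iff_continuousAt.2 fun t => (hKt t).continuousAt
  have hYc : Continuous Y := hY.continuous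
  have hY'c : Continuous (deriv Y) := hY.continuous_deriv le_rfl
  have hY's : HasCompactSupport (deriv Y) := hYs.deriv
  -- the truncated tail kernel `G = 𝟙_{(0,∞)}·|K̃|`, integrable on `ℝ`
  set Gk : ℝ → ℝ := (Ioi (0 : ℝ)).indicator fun t => |Kt t| with hGk
  have hGki : Integrable Gk := ((integrable_indicator_iff measurableSet_Ioi).2 hKti.norm).congr
    (ae_of_all _ fun t => by simp only [hGk, Real.norm_eq_abs])
  -- the exterior function
  set g : ℝ → ℂ := (Ioi e).indicator fun x => ∫ σ : ℝ, ((K (x - σ) : ℝ) : ℂ) * Y σ with hg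
  have hgc : Continuous fun x : ℝ => ∫ σ : ℝ, ((K (x - σ) : ℝ) : ℂ) * Y σ := continuous_piece hKc hYc hYs
  have hgm : AEStronglyMeasurable g volume := (hgc.aestronglyMeasurable).indicator measurableSet_Ioi
  -- domination `‖g x‖ ≤ ∫ Gk(x−σ)‖Y′ σ‖ dσ`
  have hdom : ∀ x : ℝ, ‖g x‖ ≤ ∫ σ : ℝ, Gk (x - σ) * ‖deriv Y σ‖ := by
    intro x
    have hnn : 0 ≤ ∫ σ : ℝ, Gk (x - σ) * ‖deriv Y σ‖ :=
      integral_nonneg fun σ => mul_nonneg (Set.indicator_nonneg (fun _ _ => abs_nonneg _) _) (norm_nonneg _)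
    by_cases hx : x ∈ Ioi e
    · simp only [hg, Set.indicator_of_mem hx]
      rw [kernel_piece_eq_antideriv_piece_deriv hKt hKc hY hYs x]
      obtain ⟨C, hC⟩ := hY's.exists_bound_of_continuous hY'c
      have hint : Integrable fun σ : ℝ => Gk (x - σ) * ‖deriv Y σ‖ := by
        have h1 : Integrable fun σ : ℝ => Gk (x - σ) := hGki.comp_sub_left x
        have h2 : Integrable fun σ : ℝ => ‖deriv Y σ‖ * Gk (x - σ) :=
          h1.bdd_mul (c := C) hY'c.norm.aestronglyMeasurable (ae_of_all _ fun σ => by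
            rw [Real.norm_eq_abs, abs_norm]; exact hC σ)
        exact h2.congr (ae_of_all _ fun σ => by simp only [mul_comm])
      refine norm_integral_le_of_norm_le hint (ae_of_all _ fun σ => ?_)
      rw [norm_mul, Complex.norm_real, Real.norm_eq_abs]
      by_cases hσ : e ≤ σ
      · rw [deriv_eq_zero_of_clamped hY hYe hσ, norm_zero, mul_zero, mul_zero]
      · have hpos : x - σ ∈ Ioi (0 : ℝ) := by
          simp only [mem_Ioi] at hx ⊢; push Not at hσ; linarith
        simp only [hGk, Set.indicator_of_mem hpos]
        exact le_rfl
    · simp only [hg, Set.indicator_of_notMem hx, norm_zero]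
      exact hnn
  have hf2 : MemLp (deriv Y) 2 volume := hY'c.memLp_of_hasCompactSupport hY's
  obtain ⟨_, hle⟩ := integral_sq_norm_le_of_norm_le_integral_mul hGki hf2 hgm (ae_of_all _ hdom)
  -- identify both sides
  have hlhs : ∫ x in Ioi e, ‖∫ σ : ℝ, ((K (x - σ) : ℝ) : ℂ) * Y σ‖ ^ 2 = ∫ x, ‖g x‖ ^ 2 := by
    rw [← MeasureTheory.integral_indicator measurableSet_Ioi]
    refine integral_congr_ae (ae_of_all _ fun x => ?_)
    by_cases hx : x ∈ Ioi e
    · simp only [hg, Set.indicator_of_mem hx]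
    · simp only [hg, Set.indicator_of_notMem hx, norm_zero, ne_eq, OfNat.ofNat_ne_zero, not_false_eq_true, zero_pow]
  have hK1 : ∫ t, |Gk t| = ∫ t in Ioi 0, |Kt t| := by
    rw [← MeasureTheory.integral_indicator measurableSet_Ioi]
    refine integral_congr_ae (ae_of_all _ fun t => ?_)
    by_cases ht : t ∈ Ioi (0 : ℝ)
    · simp only [hGk, Set.indicator_of_mem ht, abs_abs]
    · simp only [hGk, Set.indicator_of_notMem ht, abs_zero]
  rw [hlhs, ← hK1]
  exact hle

end Summit.NavierStokesRegularity.NavierStokesRegularity.Theorems.MatchedKernel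

end
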